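import Summits.AtomisticToContinuum.FouriersLaw.Theorems.ContactStieltjesMeasureStieltjesRepresentationPencilIdentitiesB
import Summits.AtomisticToContinuum.FouriersLaw.Theorems.ContactStieltjesMeasureStieltjesRepresentationPencilDense

/-!
# Stub `stub_pencilOfGreenKubo` of line `cayley-pencil` (crux `ContactStieltjesMeasure.StieltjesRepresentation`,
# stmt-AtomisticToContinuum-15248), part 6c: the pencil core on `L²(μ_T) ⊕₂ L²(μ_T)` from a pair of Poisson solvers

Helper file (`--supports stmt-AtomisticToContinuum-15248`). Pinned anharmonic chain (`ω₂ > 0`, `lam, β ≥ 0`), `N ≥ 2`, `T > 0`,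
`μ = μ_T` (Gibbs measure, friction-independent), `K = L²(μ) ⊕₂ L²(μ)`. Given two SOLVERS `solF, solB : ℝ → (X → ℝ) → (X → ℝ)`
which, for every friction `γ > 0` and every adjoint field `v = D*F` of a nice field `F`, return smooth `O(e^{H/(8T)})` solutions of
the forward Poisson problem `L_γ (solF γ v) = -v` and of the flipped problem `L_γ (solB γ v) = -(v∘Θ)`, the theorem
`exists_core_of_solvers` builds the CORE of the abstract extension lemma (part 1):
* `E` = the submodule of nice fields, `ι : E →ₗ K` the inclusion (dense range: part 6b),
* `Tm γ F = D(solF γ (D*F))`, `Tm' γ F = D((solB γ (D*F))∘Θ)` as elements of `K`,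
and verifies (E₀), (E₀'), (A₀), (C₀) from parts 5a/5b (the `L²(μ)` inner products are `Z⁻¹ ×` the Gibbs-weighted
integrals), together with the bookkeeping identity `⟪ι F, Tm γ F⟫ = Z⁻¹ ∫ (solF γ v_F)·v_F ρ` and the membership criterion
for `E` used by the Green–Kubo link (part 6d). No definitions (everything is packaged existentially).
-/

noncomputable section

open MeasureTheory Filter Topology Set Function
open scoped ContDiff NNReal ENNReal
open Literature.MathematicalPhysics.KineticTheory.HeatConduction

namespace Summit.AtomisticToContinuum.FouriersLaw.Theorems.ContactStieltjesMeasure.CayleyPencil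

namespace Pencil

variable {N : ℕ}

/-! ### `L²(μ)` bookkeeping -/

/-- `⟪toLp f, toLp g⟫ = ∫ f g dμ`. [folklore] -/
theorem inner_toLp_toLp {μ : Measure (PhaseSpace N)} {f g : PhaseSpace N → ℝ} (hf : MemLp f 2 μ) (hg : MemLp g 2 μ) :
    inner ℝ (hf.toLp f) (hg.toLp g) = ∫ x, f x * g x ∂μ := by
  rw [L2.inner_def]
  refine integral_congr_ae ?_
  filter_upwards [hf.coeFn_toLp, hg.coeFn_toLp] with x hx hy
  rw [hx, hy]
  simp only [RCLike.inner_apply, conj_trivial]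
  ring

/-- `‖toLp f‖² = ∫ f² dμ`. [folklore] -/
theorem norm_toLp_sq {μ : Measure (PhaseSpace N)} {f : PhaseSpace N → ℝ} (hf : MemLp f 2 μ) :
    ‖hf.toLp f‖ ^ 2 = ∫ x, f x ^ 2 ∂μ := by
  rw [← real_inner_self_eq_norm_sq, inner_toLp_toLp hf hf]
  exact integral_congr_ae (Eventually.of_forall fun x => by ring)

section Pinned

variable {ω₂ lam β : ℝ} (hω : 0 < ω₂) (hl : 0 ≤ lam) (hβ : 0 ≤ β) (hN : 2 ≤ N) {T : ℝ} (hT : 0 < T)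
include hω hl hβ hN hT

omit hω hl hβ hN hT in
/-- A continuous `f` with `f² ρ ∈ L¹(dx)` is in `L²(μ_T)`. [folklore] -/
theorem memLp_of_integrable_sq_mul (γ : ℝ) {f : PhaseSpace N → ℝ} (hf : Continuous f)
    (h : Integrable fun x => f x ^ 2 * (pinnedChain ω₂ lam β γ).gibbsDensity N T x) :
    MemLp f 2 ((pinnedChain ω₂ lam β γ).gibbsMeasure N T) :=
  (memLp_two_iff_integrable_sq hf.aestronglyMeasurable).2 ((pinnedChain ω₂ lam β γ).integrable_gibbsMeasure h)

omit hN in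
/-- A continuous `O(e^{H/(16T)})` function is in `L²(μ_T)` and its square is `ρ`-integrable. [folklore] -/
theorem memLp_of_nice (γ : ℝ) {f : PhaseSpace N → ℝ} (hf : Continuous f) {A : ℝ}
    (hfb : ∀ y, |f y| ≤ A * Real.exp ((pinnedChain ω₂ lam β γ).hamiltonian N y / (16 * T))) :
    Integrable (fun x => f x ^ 2 * (pinnedChain ω₂ lam β γ).gibbsDensity N T x) ∧
      MemLp f 2 ((pinnedChain ω₂ lam β γ).gibbsMeasure N T) := by
  have hA : 0 ≤ A := by
    have h := hfb (0 : PhaseSpace N)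
    exact nonneg_of_mul_nonneg_left ((abs_nonneg _).trans h) (Real.exp_pos _)
  have hfb' : ∀ y, |f y| ≤ A * Real.exp ((pinnedChain ω₂ lam β γ).hamiltonian N y / (8 * T)) := fun y =>
    (hfb y).trans (mul_le_mul_of_nonneg_left (Real.exp_le_exp.2 (div_le_div_of_nonneg_left
      (pinnedChain_hamiltonian_nonneg hω.le hl hβ γ N y) (by positivity) (by linarith))) hA)
  obtain ⟨h, -⟩ := HonestZwanzig.OrthogonalOhmLine.DirichletBound.integrable_weights (N := N) (γ := γ) (w := f) (g := f)
    hω hl hβ hT hf hf hfb' hfb'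
  have h' : Integrable (fun x => f x ^ 2 * (pinnedChain ω₂ lam β γ).gibbsDensity N T x) :=
    h.congr (Eventually.of_forall fun x => by ring)
  exact ⟨h', memLp_of_integrable_sq_mul γ hf h'⟩

/-! ### The core -/

/-- **The pencil core from a pair of Poisson solvers.** See the module docstring: `E` (nice fields), `ι` (dense inclusion into
`K = L²(μ_T) ⊕₂ L²(μ_T)`), `Tm γ = D ∘ solF γ ∘ D*`, `Tm' γ = D ∘ (·∘Θ) ∘ solB γ ∘ D*`, with (E₀), (E₀'), (A₀), (C₀), the
bookkeeping identity for `⟪ι F, Tm γ F⟫`, and the membership criterion. [cite: LaxPhillips1967, Ch. II §3] -/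
theorem exists_core_of_solvers (solF solB : ℝ → (PhaseSpace N → ℝ) → (PhaseSpace N → ℝ))
    (hsolF : ∀ γ : ℝ, 0 < γ → ∀ (F₀ F₁ v : PhaseSpace N → ℝ), ContDiff ℝ ∞ F₀ → ContDiff ℝ ∞ F₁ → ∀ A : ℝ, 0 ≤ A →
      (∀ y, |F₀ y| ≤ A * Real.exp ((pinnedChain ω₂ lam β γ).hamiltonian N y / (16 * T)) ∧
        |partialP ⟨0, by omega⟩ F₀ y| ≤ A * Real.exp ((pinnedChain ω₂ lam β γ).hamiltonian N y / (16 * T)) ∧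
        |F₁ y| ≤ A * Real.exp ((pinnedChain ω₂ lam β γ).hamiltonian N y / (16 * T)) ∧
        |partialP ⟨N - 1, by omega⟩ F₁ y| ≤ A * Real.exp ((pinnedChain ω₂ lam β γ).hamiltonian N y / (16 * T))) →
      (∀ x, v x = Real.sqrt T * (-partialP ⟨0, by omega⟩ F₀ x + x.2 ⟨0, by omega⟩ * F₀ x / T) +
        Real.sqrt T * (-partialP ⟨N - 1, by omega⟩ F₁ x + x.2 ⟨N - 1, by omega⟩ * F₁ x / T)) →
      ContDiff ℝ ∞ (solF γ v) ∧
        (∃ K : ℝ, ∀ y, |solF γ v y| ≤ K * Real.exp ((pinnedChain ω₂ lam β γ).hamiltonian N y / (8 * T))) ∧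
        ∀ x, (pinnedChain ω₂ lam β γ).generator N T T (solF γ v) x = -v x)
    (hsolB : ∀ γ : ℝ, 0 < γ → ∀ (F₀ F₁ v : PhaseSpace N → ℝ), ContDiff ℝ ∞ F₀ → ContDiff ℝ ∞ F₁ → ∀ A : ℝ, 0 ≤ A →
      (∀ y, |F₀ y| ≤ A * Real.exp ((pinnedChain ω₂ lam β γ).hamiltonian N y / (16 * T)) ∧
        |partialP ⟨0, by omega⟩ F₀ y| ≤ A * Real.exp ((pinnedChain ω₂ lam β γ).hamiltonian N y / (16 * T)) ∧
        |F₁ y| ≤ A * Real.exp ((pinnedChain ω₂ lam β γ).hamiltonian N y / (16 * T)) ∧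
        |partialP ⟨N - 1, by omega⟩ F₁ y| ≤ A * Real.exp ((pinnedChain ω₂ lam β γ).hamiltonian N y / (16 * T))) →
      (∀ x, v x = Real.sqrt T * (-partialP ⟨0, by omega⟩ F₀ x + x.2 ⟨0, by omega⟩ * F₀ x / T) +
        Real.sqrt T * (-partialP ⟨N - 1, by omega⟩ F₁ x + x.2 ⟨N - 1, by omega⟩ * F₁ x / T)) →
      ContDiff ℝ ∞ (solB γ v) ∧
        (∃ K : ℝ, ∀ y, |solB γ v y| ≤ K * Real.exp ((pinnedChain ω₂ lam β γ).hamiltonian N y / (8 * T))) ∧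
        ∀ x, (pinnedChain ω₂ lam β γ).generator N T T (solB γ v) x = -v (x.1, -x.2)) :
    ∃ (E : Submodule ℝ ((PhaseSpace N → ℝ) × (PhaseSpace N → ℝ)))
      (ι : E →ₗ[ℝ] WithLp 2 (Lp ℝ 2 ((pinnedChain ω₂ lam β 1).gibbsMeasure N T) ×
        Lp ℝ 2 ((pinnedChain ω₂ lam β 1).gibbsMeasure N T)))
      (Tm Tm' : ℝ → E → WithLp 2 (Lp ℝ 2 ((pinnedChain ω₂ lam β 1).gibbsMeasure N T) ×
        Lp ℝ 2 ((pinnedChain ω₂ lam β 1).gibbsMeasure N T))),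
      DenseRange ι ∧
      (∀ γ : ℝ, 0 < γ → ∀ u, inner ℝ (ι u) (Tm γ u) = γ * ‖Tm γ u‖ ^ 2) ∧
      (∀ γ : ℝ, 0 < γ → ∀ u, inner ℝ (ι u) (Tm' γ u) = γ * ‖Tm' γ u‖ ^ 2) ∧
      (∀ γ : ℝ, 0 < γ → ∀ u u', inner ℝ (Tm γ u) (ι u') = inner ℝ (ι u) (Tm' γ u')) ∧
      (∀ γ γ' : ℝ, 0 < γ → 0 < γ' → ∀ u u',
        inner ℝ (Tm γ u - Tm γ' u) (ι u') = (γ' - γ) * inner ℝ (Tm γ' u) (Tm' γ u')) ∧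
      (∀ γ : ℝ, 0 < γ → ∀ u : E,
        inner ℝ (ι u) (Tm γ u) = (∫ x, (pinnedChain ω₂ lam β 1).gibbsDensity N T x)⁻¹ *
          ∫ x, solF γ (fun y => Real.sqrt T * (-partialP ⟨0, by omega⟩ (u : (PhaseSpace N → ℝ) × (PhaseSpace N → ℝ)).1 y +
              y.2 ⟨0, by omega⟩ * (u : (PhaseSpace N → ℝ) × (PhaseSpace N → ℝ)).1 y / T) +
            Real.sqrt T * (-partialP ⟨N - 1, by omega⟩ (u : (PhaseSpace N → ℝ) × (PhaseSpace N → ℝ)).2 y +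
              y.2 ⟨N - 1, by omega⟩ * (u : (PhaseSpace N → ℝ) × (PhaseSpace N → ℝ)).2 y / T)) x *
            (Real.sqrt T * (-partialP ⟨0, by omega⟩ (u : (PhaseSpace N → ℝ) × (PhaseSpace N → ℝ)).1 x +
              x.2 ⟨0, by omega⟩ * (u : (PhaseSpace N → ℝ) × (PhaseSpace N → ℝ)).1 x / T) +
            Real.sqrt T * (-partialP ⟨N - 1, by omega⟩ (u : (PhaseSpace N → ℝ) × (PhaseSpace N → ℝ)).2 x +
              x.2 ⟨N - 1, by omega⟩ * (u : (PhaseSpace N → ℝ) × (PhaseSpace N → ℝ)).2 x / T)) *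
            (pinnedChain ω₂ lam β 1).gibbsDensity N T x) ∧
      (∀ F₀ F₁ : PhaseSpace N → ℝ, ContDiff ℝ ∞ F₀ → ContDiff ℝ ∞ F₁ →
        (∃ A : ℝ, 0 ≤ A ∧ ∀ y, |F₀ y| ≤ A * Real.exp ((pinnedChain ω₂ lam β 1).hamiltonian N y / (16 * T)) ∧
          |partialP ⟨0, by omega⟩ F₀ y| ≤ A * Real.exp ((pinnedChain ω₂ lam β 1).hamiltonian N y / (16 * T)) ∧
          |F₁ y| ≤ A * Real.exp ((pinnedChain ω₂ lam β 1).hamiltonian N y / (16 * T)) ∧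
          |partialP ⟨N - 1, by omega⟩ F₁ y| ≤ A * Real.exp ((pinnedChain ω₂ lam β 1).hamiltonian N y / (16 * T))) →
        (F₀, F₁) ∈ E) := by
  classical
  set P := pinnedChain ω₂ lam β 1 with hP
  set μ := P.gibbsMeasure N T with hμ
  set ρ := P.gibbsDensity N T with hρ
  set H := P.hamiltonian N with hH
  set b₀ : Fin N := ⟨0, by omega⟩ with hb₀
  set b₁ : Fin N := ⟨N - 1, by omega⟩ with hb₁
  haveI : IsProbabilityMeasure μ := pinnedChain_isProbabilityMeasure_gibbsMeasure hω hl hβ 1 N hT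
  -- the niceness predicate and the submodule of nice fields
  let NiceP : ((PhaseSpace N → ℝ) × (PhaseSpace N → ℝ)) → Prop := fun F =>
    ContDiff ℝ ∞ F.1 ∧ ContDiff ℝ ∞ F.2 ∧ ∃ A : ℝ, 0 ≤ A ∧ ∀ y, |F.1 y| ≤ A * Real.exp (H y / (16 * T)) ∧
      |partialP b₀ F.1 y| ≤ A * Real.exp (H y / (16 * T)) ∧ |F.2 y| ≤ A * Real.exp (H y / (16 * T)) ∧
      |partialP b₁ F.2 y| ≤ A * Real.exp (H y / (16 * T))
  have he0 : ∀ y, 0 ≤ Real.exp (H y / (16 * T)) := fun y => (Real.exp_pos _).le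
  let E : Submodule ℝ ((PhaseSpace N → ℝ) × (PhaseSpace N → ℝ)) :=
    { carrier := {F | NiceP F}
      zero_mem' := by
        refine ⟨contDiff_const, contDiff_const, 0, le_rfl, fun y => ?_⟩
        have h0 : ∀ i, partialP i (fun _ : PhaseSpace N => (0 : ℝ)) y = 0 := fun i => by
          unfold partialP; exact deriv_const _ _
        simp only [Prod.fst_zero, Prod.snd_zero, Pi.zero_apply, abs_zero, zero_mul, le_refl, true_and]
        exact ⟨by rw [show (0 : PhaseSpace N → ℝ) = fun _ => 0 from rfl, h0, abs_zero],
          by rw [show (0 : PhaseSpace N → ℝ) = fun _ => 0 from rfl, h0, abs_zero]⟩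
      add_mem' := by
        rintro F G ⟨hF1, hF2, A, hA, hFb⟩ ⟨hG1, hG2, B, hB, hGb⟩
        refine ⟨hF1.add hG1, hF2.add hG2, A + B, by positivity, fun y => ?_⟩
        have hd1 := partialP_add (hF1.differentiable (by simp)) (hG1.differentiable (by simp)) b₀ y
        have hd2 := partialP_add (hF2.differentiable (by simp)) (hG2.differentiable (by simp)) b₁ y
        obtain ⟨h1, h2, h3, h4⟩ := hFb y
        obtain ⟨k1, k2, k3, k4⟩ := hGb y
        simp only [Prod.fst_add, Prod.snd_add, Pi.add_apply]
        refine ⟨?_, ?_, ?_, ?_⟩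
        · rw [add_mul]; exact (abs_add_le _ _).trans (add_le_add h1 k1)
        · rw [hd1, add_mul]
          exact (abs_add_le _ _).trans (add_le_add h2 k2)
        · rw [add_mul]; exact (abs_add_le _ _).trans (add_le_add h3 k3)
        · rw [hd2, add_mul]
          exact (abs_add_le _ _).trans (add_le_add h4 k4)
      smul_mem' := by
        rintro c F ⟨hF1, hF2, A, hA, hFb⟩
        refine ⟨contDiff_const.mul hF1, contDiff_const.mul hF2, |c| * A, by positivity, fun y => ?_⟩
        obtain ⟨h1, h2, h3, h4⟩ := hFb y
        simp only [Prod.smul_fst, Prod.smul_snd, Pi.smul_apply, smul_eq_mul]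
        refine ⟨?_, ?_, ?_, ?_⟩
        · rw [abs_mul, mul_assoc]; exact mul_le_mul_of_nonneg_left h1 (abs_nonneg _)
        · rw [show (c • F.1) = fun z => c * F.1 z from rfl, partialP_const_mul, abs_mul, mul_assoc]
          exact mul_le_mul_of_nonneg_left h2 (abs_nonneg _)
        · rw [abs_mul, mul_assoc]; exact mul_le_mul_of_nonneg_left h3 (abs_nonneg _)
        · rw [show (c • F.2) = fun z => c * F.2 z from rfl, partialP_const_mul, abs_mul, mul_assoc]
          exact mul_le_mul_of_nonneg_left h4 (abs_nonneg _) }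
  have hmem : ∀ {F}, F ∈ E ↔ NiceP F := fun {F} => Iff.rfl
  -- `L²` membership of nice components
  have hLp : ∀ {F}, NiceP F → MemLp F.1 2 μ ∧ MemLp F.2 2 μ := by
    rintro F ⟨hF1, hF2, A, hA, hFb⟩
    exact ⟨(memLp_of_nice hω hl hβ hT 1 hF1.continuous (fun y => (hFb y).1)).2,
      (memLp_of_nice hω hl hβ hT 1 hF2.continuous (fun y => (hFb y).2.2.1)).2⟩
  -- the inclusion
  let ι : E →ₗ[ℝ] WithLp 2 (Lp ℝ 2 μ × Lp ℝ 2 μ) :=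
    { toFun := fun F => WithLp.toLp 2 ((hLp F.2).1.toLp F.1.1, (hLp F.2).2.toLp F.1.2)
      map_add' := by
        intro F G
        have h1 := MemLp.toLp_add (hLp F.2).1 (hLp G.2).1
        have h2 := MemLp.toLp_add (hLp F.2).2 (hLp G.2).2
        show WithLp.toLp 2 (_, _) = WithLp.toLp 2 (_ + _, _ + _)
        congr 1
      map_smul' := by
        intro c F
        have h1 := MemLp.toLp_const_smul c (hLp F.2).1
        have h2 := MemLp.toLp_const_smul c (hLp F.2).2
        show WithLp.toLp 2 (_, _) = WithLp.toLp 2 (c • _, c • _)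
        congr 1 }
  have hι : ∀ F : E, ι F = WithLp.toLp 2 ((hLp F.2).1.toLp F.1.1, (hLp F.2).2.toLp F.1.2) := fun F => rfl
  -- the adjoint field of a pair and the solver outputs
  let vOf : ((PhaseSpace N → ℝ) × (PhaseSpace N → ℝ)) → PhaseSpace N → ℝ := fun F x =>
    Real.sqrt T * (-partialP b₀ F.1 x + x.2 b₀ * F.1 x / T) + Real.sqrt T * (-partialP b₁ F.2 x + x.2 b₁ * F.2 x / T)
  have hvOf : ∀ F x, vOf F x = Real.sqrt T * (-partialP b₀ F.1 x + x.2 b₀ * F.1 x / T) +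
      Real.sqrt T * (-partialP b₁ F.2 x + x.2 b₁ * F.2 x / T) := fun F x => rfl
  -- forward data of a nice pair at friction `γ > 0`
  have hFdata : ∀ {γ : ℝ} (hγ : 0 < γ) {F} (hF : NiceP F),
      ContDiff ℝ ∞ (solF γ (vOf F)) ∧
      (∃ K : ℝ, ∀ y, |solF γ (vOf F) y| ≤ K * Real.exp (H y / (8 * T))) ∧
      (∀ x, (pinnedChain ω₂ lam β γ).generator N T T (solF γ (vOf F)) x = -vOf F x) ∧
      Integrable (fun x => (partialP b₀ (solF γ (vOf F)) x) ^ 2 * ρ x) ∧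
      Integrable (fun x => (partialP b₁ (solF γ (vOf F)) x) ^ 2 * ρ x) ∧
      ((∫ x, F.1 x * (Real.sqrt T * partialP b₀ (solF γ (vOf F)) x) * ρ x) +
          ∫ x, F.2 x * (Real.sqrt T * partialP b₁ (solF γ (vOf F)) x) * ρ x =
        γ * ((∫ x, (Real.sqrt T * partialP b₀ (solF γ (vOf F)) x) ^ 2 * ρ x) +
          ∫ x, (Real.sqrt T * partialP b₁ (solF γ (vOf F)) x) ^ 2 * ρ x)) := by
    intro γ hγ F hF
    obtain ⟨hF1, hF2, A, hA, hFb⟩ := hF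
    obtain ⟨hws, ⟨K, hwb⟩, hLw⟩ := hsolF γ hγ F.1 F.2 (vOf F) hF1 hF2 A hA hFb (hvOf F)
    obtain ⟨hD₀, hD₁, hE⟩ := energy_identity hω hl hβ hN hT hγ hF1 hF2 hA hFb (hvOf F) hws hwb hLw
    exact ⟨hws, ⟨K, hwb⟩, hLw, hD₀, hD₁, hE⟩
  -- backward (adjoint) data of a nice pair at friction `γ > 0`
  have hBdata : ∀ {γ : ℝ} (hγ : 0 < γ) {F} (hF : NiceP F),
      ContDiff ℝ ∞ (solB γ (vOf F)) ∧
      (∃ K : ℝ, ∀ y, |solB γ (vOf F) y| ≤ K * Real.exp (H y / (8 * T))) ∧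
      (∀ x, (pinnedChain ω₂ lam β γ).generator N T T (solB γ (vOf F)) x = -vOf F (x.1, -x.2)) ∧
      ContDiff ℝ ∞ (fun x : PhaseSpace N => solB γ (vOf F) (x.1, -x.2)) ∧
      Integrable (fun x => (partialP b₀ (fun y : PhaseSpace N => solB γ (vOf F) (y.1, -y.2)) x) ^ 2 * ρ x) ∧
      Integrable (fun x => (partialP b₁ (fun y : PhaseSpace N => solB γ (vOf F) (y.1, -y.2)) x) ^ 2 * ρ x) ∧
      ((∫ x, F.1 x * (Real.sqrt T * partialP b₀ (fun y : PhaseSpace N => solB γ (vOf F) (y.1, -y.2)) x) * ρ x) +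
          ∫ x, F.2 x * (Real.sqrt T * partialP b₁ (fun y : PhaseSpace N => solB γ (vOf F) (y.1, -y.2)) x) * ρ x =
        γ * ((∫ x, (Real.sqrt T * partialP b₀ (fun y : PhaseSpace N => solB γ (vOf F) (y.1, -y.2)) x) ^ 2 * ρ x) +
          ∫ x, (Real.sqrt T * partialP b₁ (fun y : PhaseSpace N => solB γ (vOf F) (y.1, -y.2)) x) ^ 2 * ρ x)) := by
    intro γ hγ F hF
    obtain ⟨hF1, hF2, A, hA, hFb⟩ := hF
    obtain ⟨hws, ⟨K, hwb⟩, hLw⟩ := hsolB γ hγ F.1 F.2 (vOf F) hF1 hF2 A hA hFb (hvOf F)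
    obtain ⟨hw's, -, -, hD₀, hD₁, hE⟩ := energy_identity_adjoint hω hl hβ hN hT hγ hF1 hF2 hA hFb (hvOf F) hws hwb hLw
    exact ⟨hws, ⟨K, hwb⟩, hLw, hw's, hD₀, hD₁, hE⟩
  -- `L²` membership of `√T ∂_b w`
  have hmemD : ∀ {w : PhaseSpace N → ℝ} (b : Fin N), ContDiff ℝ ∞ w → Integrable (fun x => (partialP b w x) ^ 2 * ρ x) →
      MemLp (fun x => Real.sqrt T * partialP b w x) 2 μ := by
    intro w b hw hI
    refine memLp_of_integrable_sq_mul 1 (continuous_const.mul (continuous_partialP hw (by simp) b)) ?_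
    have h := hI.const_mul T
    refine h.congr (Eventually.of_forall fun x => ?_)
    show T * ((partialP b w x) ^ 2 * ρ x) = (Real.sqrt T * partialP b w x) ^ 2 * ρ x
    rw [mul_pow, Real.sq_sqrt hT.le]; ring
  -- the core maps
  let Tm : ℝ → E → WithLp 2 (Lp ℝ 2 μ × Lp ℝ 2 μ) := fun γ F =>
    if hγ : 0 < γ then
      WithLp.toLp 2 ((hmemD b₀ (hFdata hγ F.2).1 (hFdata hγ F.2).2.2.2.1).toLp _,
        (hmemD b₁ (hFdata hγ F.2).1 (hFdata hγ F.2).2.2.2.2.1).toLp _)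
    else 0
  let Tm' : ℝ → E → WithLp 2 (Lp ℝ 2 μ × Lp ℝ 2 μ) := fun γ F =>
    if hγ : 0 < γ then
      WithLp.toLp 2 ((hmemD b₀ (hBdata hγ F.2).2.2.2.1 (hBdata hγ F.2).2.2.2.2.1).toLp _,
        (hmemD b₁ (hBdata hγ F.2).2.2.2.1 (hBdata hγ F.2).2.2.2.2.2.1).toLp _)
    else 0
  have hTm : ∀ {γ : ℝ} (hγ : 0 < γ) (F : E), Tm γ F =
      WithLp.toLp 2 ((hmemD b₀ (hFdata hγ F.2).1 (hFdata hγ F.2).2.2.2.1).toLp _,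
        (hmemD b₁ (hFdata hγ F.2).1 (hFdata hγ F.2).2.2.2.2.1).toLp _) := fun hγ F => by
    simp only [Tm, dif_pos hγ]
  have hTm' : ∀ {γ : ℝ} (hγ : 0 < γ) (F : E), Tm' γ F =
      WithLp.toLp 2 ((hmemD b₀ (hBdata hγ F.2).2.2.2.1 (hBdata hγ F.2).2.2.2.2.1).toLp _,
        (hmemD b₁ (hBdata hγ F.2).2.2.2.1 (hBdata hγ F.2).2.2.2.2.2.1).toLp _) := fun hγ F => by
    simp only [Tm', dif_pos hγ]
  -- inner products in `K` of pairs of `toLp`s are sums of `μ`-integrals, and `∫ · dμ = Z⁻¹ ∫ · ρ`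
  have hZ : ∀ g : PhaseSpace N → ℝ, ∫ x, g x ∂μ = (∫ x, ρ x)⁻¹ * ∫ x, g x * ρ x := fun g => P.integral_gibbsMeasure g
  have hinner : ∀ {f₁ f₂ g₁ g₂ : PhaseSpace N → ℝ} (h₁ : MemLp f₁ 2 μ) (h₂ : MemLp f₂ 2 μ) (k₁ : MemLp g₁ 2 μ)
      (k₂ : MemLp g₂ 2 μ),
      inner ℝ (WithLp.toLp 2 (h₁.toLp f₁, h₂.toLp f₂) : WithLp 2 (Lp ℝ 2 μ × Lp ℝ 2 μ))
        (WithLp.toLp 2 (k₁.toLp g₁, k₂.toLp g₂)) =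
        (∫ x, ρ x)⁻¹ * ((∫ x, f₁ x * g₁ x * ρ x) + ∫ x, f₂ x * g₂ x * ρ x) := by
    intro f₁ f₂ g₁ g₂ h₁ h₂ k₁ k₂
    rw [WithLp.prod_inner_apply]
    show inner ℝ (h₁.toLp f₁) (k₁.toLp g₁) + inner ℝ (h₂.toLp f₂) (k₂.toLp g₂) = _
    rw [inner_toLp_toLp, inner_toLp_toLp, hZ (fun x => f₁ x * g₁ x), hZ (fun x => f₂ x * g₂ x), mul_add]
  have hnormsq : ∀ {g₁ g₂ : PhaseSpace N → ℝ} (k₁ : MemLp g₁ 2 μ) (k₂ : MemLp g₂ 2 μ),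
      ‖(WithLp.toLp 2 (k₁.toLp g₁, k₂.toLp g₂) : WithLp 2 (Lp ℝ 2 μ × Lp ℝ 2 μ))‖ ^ 2 =
        (∫ x, ρ x)⁻¹ * ((∫ x, g₁ x ^ 2 * ρ x) + ∫ x, g₂ x ^ 2 * ρ x) := by
    intro g₁ g₂ k₁ k₂
    rw [WithLp.prod_norm_sq_eq_of_L2]
    show ‖k₁.toLp g₁‖ ^ 2 + ‖k₂.toLp g₂‖ ^ 2 = _
    rw [norm_toLp_sq, norm_toLp_sq, hZ (fun x => g₁ x ^ 2), hZ (fun x => g₂ x ^ 2), mul_add]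
  refine ⟨E, ι, Tm, Tm', ?_, ?_, ?_, ?_, ?_, ?_, ?_⟩
  · -- dense range: pairs of test functions are nice and dense
    intro x
    rw [Metric.mem_closure_iff]
    intro ε hε
    obtain ⟨φ, ψ, hφm, hψm, hφs, hφc, hψs, hψc, hdist⟩ := exists_testPair_near μ x hε
    obtain ⟨A, hA, hAb⟩ := testFunction_nice hω hl hβ 1 hN hT hφs hφc
    obtain ⟨B, hB, hBb⟩ := testFunction_nice hω hl hβ 1 hN hT hψs hψc
    have hmemφψ : NiceP (φ, ψ) := by
      refine ⟨hφs, hψs, A + B, by positivity, fun y => ⟨?_, ?_, ?_, ?_⟩⟩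
      · exact ((hAb y).1).trans (mul_le_mul_of_nonneg_right (by linarith) (he0 y))
      · exact ((hAb y).2.1).trans (mul_le_mul_of_nonneg_right (by linarith) (he0 y))
      · exact ((hBb y).1).trans (mul_le_mul_of_nonneg_right (by linarith) (he0 y))
      · exact ((hBb y).2.2).trans (mul_le_mul_of_nonneg_right (by linarith) (he0 y))
    refine ⟨ι ⟨(φ, ψ), hmemφψ⟩, ⟨⟨(φ, ψ), hmemφψ⟩, rfl⟩, ?_⟩
    rw [dist_eq_norm, hι]
    exact hdist
  · -- (E₀)
    intro γ hγ F
    obtain ⟨-, -, -, -, -, hE⟩ := hFdata hγ F.2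
    rw [hTm hγ F, hι F, hinner, hnormsq, hE]
    ring
  · -- (E₀')
    intro γ hγ F
    obtain ⟨-, -, -, -, -, -, hE⟩ := hBdata hγ F.2
    rw [hTm' hγ F, hι F, hinner, hnormsq, hE]
    ring
  · -- (A₀)
    intro γ hγ F F'
    obtain ⟨hF1, hF2, A, hA, hFb⟩ := F.2
    obtain ⟨hF'1, hF'2, A', hA', hF'b⟩ := F'.2
    obtain ⟨hws, ⟨K, hwb⟩, hLw⟩ := hsolF γ hγ F.1.1 F.1.2 (vOf F) hF1 hF2 A hA hFb (hvOf F)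
    obtain ⟨hw's, ⟨K', hw'b⟩, hLw'⟩ := hsolB γ hγ F'.1.1 F'.1.2 (vOf F') hF'1 hF'2 A' hA' hF'b (hvOf F')
    have h := adjoint_identity hω hl hβ hN hT hγ hF1 hF2 hF'1 hF'2 hA hA' hFb hF'b (hvOf F) (hvOf F') hws hw's hwb hw'b
      hLw hLw'
    rw [hTm hγ F, hι F', hinner, hTm' hγ F', hι F, hinner]
    congr 1
  · -- (C₀)
    intro γ γ' hγ hγ' F F'
    obtain ⟨hF1, hF2, A, hA, hFb⟩ := F.2
    obtain ⟨hF'1, hF'2, A', hA', hF'b⟩ := F'.2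
    obtain ⟨hwas, ⟨Ka, hwab⟩, hLwa⟩ := hsolF γ hγ F.1.1 F.1.2 (vOf F) hF1 hF2 A hA hFb (hvOf F)
    obtain ⟨hwcs, ⟨Kc, hwcb⟩, hLwc⟩ := hsolF γ' hγ' F.1.1 F.1.2 (vOf F) hF1 hF2 A hA hFb (hvOf F)
    obtain ⟨hw's, ⟨K', hw'b⟩, hLw'⟩ := hsolB γ hγ F'.1.1 F'.1.2 (vOf F') hF'1 hF'2 A' hA' hF'b (hvOf F')
    have h := cross_identity hω hl hβ hN hT hγ hγ' hF1 hF2 hF'1 hF'2 hA hA' hFb hF'b (hvOf F) (hvOf F') hwas hwcs hw's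
      hwab hwcb hw'b hLwa hLwc hLw'
    have m₀ := hmemD b₀ (hFdata hγ F.2).1 (hFdata hγ F.2).2.2.2.1
    have m₀' := hmemD b₀ (hFdata hγ' F.2).1 (hFdata hγ' F.2).2.2.2.1
    have m₁ := hmemD b₁ (hFdata hγ F.2).1 (hFdata hγ F.2).2.2.2.2.1
    have m₁' := hmemD b₁ (hFdata hγ' F.2).1 (hFdata hγ' F.2).2.2.2.2.1
    have hsub : Tm γ F - Tm γ' F = WithLp.toLp 2 ((m₀.sub m₀').toLp _, (m₁.sub m₁').toLp _) := by
      rw [MemLp.toLp_sub m₀ m₀', MemLp.toLp_sub m₁ m₁', hTm hγ F, hTm hγ' F]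
      rfl
    rw [hsub, hι F', hinner, hTm hγ' F, hTm' hγ F', hinner]
    simp only [Pi.sub_apply]
    rw [mul_left_comm]
    congr 1
  · -- bookkeeping: `⟪ι F, Tm γ F⟫ = Z⁻¹ ∫ w v_F ρ`
    intro γ hγ F
    obtain ⟨hF1, hF2, A, hA, hFb⟩ := F.2
    obtain ⟨hws, ⟨K, hwb⟩, -, hD₀, hD₁, -⟩ := hFdata hγ F.2
    have hpair : (∫ x, Real.sqrt T * partialP b₀ (solF γ (vOf F)) x * F.1.1 x * ρ x) +
        ∫ x, Real.sqrt T * partialP b₁ (solF γ (vOf F)) x * F.1.2 x * ρ x =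
        ∫ x, solF γ (vOf F) x * vOf F x * ρ x :=
      sum_integral_partialP_mul_eq hω hl hβ hN hT γ hF1 hF2 hA hFb (hvOf F) hws hwb hD₀ hD₁
    rw [hTm hγ F, hι F, hinner]
    congr 1
    rw [← hpair]
    congr 1 <;> exact integral_congr_ae (Eventually.of_forall fun x => by ring)
  · -- membership criterion
    intro F₀ F₁ hF₀ hF₁ hb
    exact (hmem).2 ⟨hF₀, hF₁, hb⟩

end Pinned

end Pencil

/-! ## Registered helper stub -/

open Pencil in
/-- **Registered sub-goal `stub_pencilOfGreenKubo_core`** of the crux (this file's ticket): continuous observables with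
`f²ρ ∈ L¹` are in `L²(μ_T)` (= `Pencil.memLp_of_integrable_sq_mul`, the `L²` bookkeeping behind the core). [folklore] -/
theorem stub_pencilOfGreenKubo_core :
    ∀ (N : ℕ) (ω₂ lam β γ T : ℝ) (f : Literature.MathematicalPhysics.KineticTheory.HeatConduction.PhaseSpace N → ℝ), Continuous f → MeasureTheory.Integrable (fun x => f x ^ 2 * (Literature.MathematicalPhysics.KineticTheory.HeatConduction.pinnedChain ω₂ lam β γ).gibbsDensity N T x) MeasureTheory.volume → MeasureTheory.MemLp f 2 ((Literature.MathematicalPhysics.KineticTheory.HeatConduction.pinnedChain ω₂ lam β γ).gibbsMeasure N T) :=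
  fun _ _ _ _ γ _ _ hf h => memLp_of_integrable_sq_mul γ hf h

end Summit.AtomisticToContinuum.FouriersLaw.Theorems.ContactStieltjesMeasure.CayleyPencil

end
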